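import Summits.NavierStokesRegularity.NavierStokesRegularity.Theorems.QuarterLogPincerLogCubeSharpPhiSlice
import Literature.Analysis.FluidPDE.ClassicalSolution
import Literature.Analysis.FluidPDE.SpaceTimeCalculus
import Literature.Analysis.FluidPDE.NSCriticalClosureTao
import Literature.Analysis.FluidPDE.EnstrophySplitting
import HarnessLib

/-!
# `QuarterLogPincer.LogCubeSharp` (item stmt-NavierStokesRegularity-23935), rung 2: the
# regularised `L³` energy inequality of a classical solution on a slab

Helper file (`--supports stmt-NavierStokesRegularity-23935`) of the crux `LogCubeSharp` of route
`QuarterLogPincer` (sharp logarithmic cube ceiling). With the regularised cube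
`Φ(v) = (‖v‖²+1)^{3/2} − 1` and its weight `ρ = (‖v‖²+1)^{1/2}` (tools file
`QuarterLogPincerLogCubeSharpPhiTools.lean`) and the three whole-space slice identities
(`QuarterLogPincerLogCubeSharpPhiSlice.lean`), this file proves the `L³` ENERGY INEQUALITY of the
planner's rung 2 in integrated form, for a classical solution of the unforced Navier–Stokes system:

* `integral_rho_inner_timeDeriv_le` — THE SLICE BOUND at a time `τ` of the time set:
  `∫ 3ρ⟪u, ∂ₜu⟫ ≤ 3 · M · a · b` whenever `|u(τ)| ≤ M`, `‖q(τ)‖₂ ≤ a`, `‖Du(τ)‖₂ ≤ b`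
  (momentum equation `∂ₜu = νΔu − (u·∇)u − ∇q`; dissipation `∫ρ⟪u,Δu⟫ ≤ 0`, transport
  `∫ρ⟪u,Du u⟫ = 0`, pressure `|∫ρ⟪u,∇q⟫| ≤ ∫|q||u|‖Du‖ ≤ M‖q‖₂‖Du‖₂`);
* `integral_phi_le_of_slice_le` — THE INTEGRATED INEQUALITY on a closed slab `[0, S]` for a
  bounded classical solution with `u, ∂ₜu ∈ L^∞_t L²_x` (the Tao class):
  `∫ Φ(u(S)) ≤ ∫ Φ(u(0)) + ∫_{(0,S)} D` whenever the slice functional is `≤ D(τ)` on `(0, S)`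
  with `D` integrable — pointwise fundamental theorem of calculus in `t` and Fubini on
  `(0,S) × E` (the integrand `3ρ⟪u,∂ₜu⟫` is jointly continuous and dominated by
  `3(B+1)(‖u‖² + ‖∂ₜu‖²)`); NO spatial cut-off and NO limiting procedure, because `Φ` is smooth
  and `‖v‖³ ≤ Φ(v) ≤ (‖v‖ + 3/2)‖v‖²`.

The closing file feeds `M = C_I/√(T−τ)` (velocity Type I), `a ≲ ‖u(τ)‖₄² ≲ (T−τ)^{-1/4}`
(Riesz pressure in `L²`, rung 1) and `b = ‖curl u(τ)‖₂ ≤ √K (T−τ)^{-1/4}` (quarter law), so that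
`D(τ) ≲ (T−τ)^{-1}` integrates to the logarithm of the crux.

HONEST FRAMING: a-priori identities/inequalities for a GIVEN classical solution; the crux
`LogCubeSharp` is NOT closed by this file, and Navier–Stokes regularity is NOT proved here, nor
claimed. References: Escauriaza–Seregin–Šverák 2003, Seregin 2012 (`L³` energy method); Evans, PDE,
App. C.2. [folklore]
-/

noncomputable section

open MeasureTheory TopologicalSpace Set Function Filter Topology InnerProductSpace
open Literature.Analysis Literature.Analysis.FluidPDE
open scoped RealInnerProductSpace ENNReal NNReal Laplacian

namespace Summit.NavierStokesRegularity.NavierStokesRegularity.Theorems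

set_option linter.dupNamespace false

namespace LogCubeSharp


/-! ### The slice bound for a Tao-class classical solution -/

section SliceBound

variable {E : Type*} [NormedAddCommGroup E] [InnerProductSpace ℝ E] [FiniteDimensional ℝ E]
  [MeasurableSpace E] [BorelSpace E]

omit [MeasurableSpace E] [BorelSpace E] in
/-- `‖Δ v (x)‖ ≤ d · ‖D²v(x)‖` for a `C²` field (`Δv = Σᵢ D²v[bᵢ,bᵢ]`). [folklore] -/
theorem norm_laplacian_le {F' : Type*} [NormedAddCommGroup F'] [InnerProductSpace ℝ F']
    {v : E → F'} (hv : ContDiff ℝ 2 v) (x : E) :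
    ‖(Δ v) x‖ ≤ (Module.finrank ℝ E : ℝ) * ‖iteratedFDeriv ℝ 2 v x‖ := by
  let b := stdOrthonormalBasis ℝ E
  have hb1 : ∀ i, ‖b i‖ = 1 := fun i => b.orthonormal.1 i
  rw [laplacian_eq_sum_fderiv_fderiv b hv x]
  calc ‖∑ i, fderiv ℝ (fun y => fderiv ℝ v y (b i)) x (b i)‖
      ≤ ∑ i, ‖fderiv ℝ (fun y => fderiv ℝ v y (b i)) x (b i)‖ := norm_sum_le _ _
    _ ≤ ∑ _i : Fin (Module.finrank ℝ E), ‖iteratedFDeriv ℝ 2 v x‖ := by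
        refine Finset.sum_le_sum fun i _ => ?_
        rw [fderiv_fderiv_apply_const hv x (b i)]
        refine (ContinuousMultilinearMap.le_opNorm _ _).trans ?_
        simp [Fin.prod_univ_two, hb1]
    _ = (Module.finrank ℝ E : ℝ) * ‖iteratedFDeriv ℝ 2 v x‖ := by
        rw [Finset.sum_const, Finset.card_univ, Fintype.card_fin, nsmul_eq_mul]

/-- `∫ |q| ‖Du‖ ≤ a · b` when `‖q‖₂ ≤ a`, `‖Du‖₂ ≤ b` (Hölder). [folklore] -/
theorem integral_norm_mul_norm_le_of_eLpNorm_le {F₁ F₂ : Type*} [NormedAddCommGroup F₁]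
    [NormedAddCommGroup F₂] {f : E → F₁} {g : E → F₂} (hf : MemLp f 2 volume)
    (hg : MemLp g 2 volume) {a b : ℝ} (ha : 0 ≤ a) (hb : 0 ≤ b)
    (hfa : eLpNorm f 2 volume ≤ ENNReal.ofReal a) (hgb : eLpNorm g 2 volume ≤ ENNReal.ofReal b) :
    ∫ x, ‖f x‖ * ‖g x‖ ≤ a * b := by
  have hint : Integrable (fun x => ‖f x‖ * ‖g x‖) volume := integrable_norm_mul_norm hf hg
  have hH : eLpNorm (fun x => ‖f x‖ * ‖g x‖) 1 volume ≤ eLpNorm f 2 volume * eLpNorm g 2 volume := by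
    have h := eLpNorm_smul_le_mul_eLpNorm (p := 2) (q := 2) (r := 1) hg.1.norm hf.1.norm
      (μ := volume)
    have heq : ((fun y => ‖f y‖) • fun y => ‖g y‖) = fun y => ‖f y‖ * ‖g y‖ := rfl
    rw [heq, eLpNorm_norm, eLpNorm_norm] at h
    exact h
  have h1 : ENNReal.ofReal (∫ x, ‖f x‖ * ‖g x‖) ≤ ENNReal.ofReal (a * b) := by
    rw [ofReal_integral_eq_lintegral_ofReal hint
      (Eventually.of_forall fun x => mul_nonneg (norm_nonneg _) (norm_nonneg _)),
      ENNReal.ofReal_mul ha]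
    calc ∫⁻ x, ENNReal.ofReal (‖f x‖ * ‖g x‖)
        = eLpNorm (fun x => ‖f x‖ * ‖g x‖) 1 volume := by
          rw [eLpNorm_one_eq_lintegral_enorm]
          refine lintegral_congr fun x => ?_
          rw [Real.enorm_eq_ofReal (mul_nonneg (norm_nonneg _) (norm_nonneg _))]
      _ ≤ eLpNorm f 2 volume * eLpNorm g 2 volume := hH
      _ ≤ ENNReal.ofReal a * ENNReal.ofReal b := mul_le_mul' hfa hgb
  exact (ENNReal.ofReal_le_ofReal_iff (mul_nonneg ha hb)).1 h1

/-- **The slice bound.** For a classical solution of the unforced Navier–Stokes system (`ν ≥ 0`)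
at a time `τ` of an open time set `S`, with `u(τ) ∈ L² ∩ L^∞`, `Du(τ), D²u(τ), q(τ), ∇q(τ) ∈ L²`,
`∂ₜu(τ) ∈ L²`: `∫ 3ρ⟪u, ∂ₜu⟫ ≤ 3 · M · a · b` whenever `|u(τ)| ≤ M`, `‖q(τ)‖₂ ≤ a`,
`‖Du(τ)‖₂ ≤ b` (momentum equation, dissipation `≤ 0`, transport `= 0`, pressure
`≤ ∫|q||u|‖Du‖ ≤ M‖q‖₂‖Du‖₂`). [folklore] -/
theorem integral_rho_inner_timeDeriv_le {S : Set ℝ} {ν : ℝ} (hν : 0 ≤ ν)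
    {u : ℝ → E → E} {q : ℝ → E → ℝ} (hcl : IsClassicalNSSolutionOn S ν 0 u q) {τ : ℝ} (hτ : τ ∈ S)
    {M a b : ℝ} (hM : ∀ x, ‖u τ x‖ ≤ M) (ha : 0 ≤ a) (hb : 0 ≤ b)
    (hu2 : MemLp (u τ) 2 volume) (hDu : MemLp (fun x => fderiv ℝ (u τ) x) 2 volume)
    (hD2u : MemLp (fun x => iteratedFDeriv ℝ 2 (u τ) x) 2 volume)
    (hq2 : MemLp (q τ) 2 volume) (hDq : MemLp (fun x => gradient (q τ) x) 2 volume)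
    (hqa : eLpNorm (q τ) 2 volume ≤ ENNReal.ofReal a)
    (hDub : eLpNorm (fun x => fderiv ℝ (u τ) x) 2 volume ≤ ENNReal.ofReal b) :
    ∫ x, 3 * Real.sqrt (‖u τ x‖ ^ 2 + 1) * ⟪u τ x, timeDerivWithin S u τ x⟫ ≤ 3 * (M * (a * b)) := by
  have hM0 : 0 ≤ M := (norm_nonneg _).trans (hM 0)
  have hu1 : ContDiff ℝ 1 (u τ) := (hcl.contDiff_velocity hτ).of_le (by norm_cast)
  have hu2' : ContDiff ℝ 2 (u τ) := (hcl.contDiff_velocity hτ).of_le (by norm_cast)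
  have hcq : ContDiff ℝ 1 (q τ) := (hcl.contDiff_pressure hτ).of_le (by norm_cast)
  have hdiv : VectorCalculus.IsDivFree (u τ) := hcl.divFree τ hτ
  have huc : Continuous (u τ) := hu1.continuous
  have hDuc : Continuous fun x => fderiv ℝ (u τ) x := hu1.continuous_fderiv one_ne_zero
  have hρc : Continuous fun x => Real.sqrt (‖u τ x‖ ^ 2 + 1) :=
    ((huc.norm.pow 2).add continuous_const).sqrt
  have hρle : ∀ x, Real.sqrt (‖u τ x‖ ^ 2 + 1) ≤ M + 1 := fun x =>
    (sqrt_normSq_add_one_le (u τ x)).trans (by linarith [hM x])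
  have hρ0 : ∀ x, 0 ≤ Real.sqrt (‖u τ x‖ ^ 2 + 1) := fun x => Real.sqrt_nonneg _
  -- the momentum equation pointwise
  have hmom : ∀ x, timeDerivWithin S u τ x =
      ν • (Δ (u τ)) x - gradient (q τ) x - fderiv ℝ (u τ) x (u τ x) := by
    intro x
    have h := hcl.momentum τ hτ x
    simp only [convect_apply, Pi.zero_apply, add_zero] at h
    rw [← h]
    abel
  -- the Laplacian slice is in `L²`
  have hLap : MemLp (fun x => (Δ (u τ)) x) 2 volume :=
    hD2u.of_le_mul (continuous_laplacian hu2').aestronglyMeasurable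
      (Eventually.of_forall fun x => norm_laplacian_le hu2' x)
  -- integrability of the three pieces
  have hI1 : Integrable (fun x => Real.sqrt (‖u τ x‖ ^ 2 + 1) * ⟪u τ x, (Δ (u τ)) x⟫) volume := by
    refine Integrable.mono' ((integrable_norm_mul_norm hu2 hLap).const_mul (M + 1))
      ((hρc.mul (huc.inner (continuous_laplacian hu2'))).aestronglyMeasurable)
      (Eventually.of_forall fun x => ?_)
    rw [norm_mul, Real.norm_eq_abs, abs_of_nonneg (hρ0 x), Real.norm_eq_abs]
    exact mul_le_mul (hρle x) (abs_real_inner_le_norm _ _) (abs_nonneg _) (by linarith)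
  have hI2 : Integrable (fun x => Real.sqrt (‖u τ x‖ ^ 2 + 1) *
      ⟪u τ x, fderiv ℝ (u τ) x (u τ x)⟫) volume := by
    refine Integrable.mono' ((integrable_norm_mul_norm hu2 hDu).const_mul ((M + 1) * M))
      ((hρc.mul (huc.inner (hDuc.clm_apply huc))).aestronglyMeasurable)
      (Eventually.of_forall fun x => ?_)
    rw [norm_mul, Real.norm_eq_abs, abs_of_nonneg (hρ0 x), Real.norm_eq_abs]
    calc Real.sqrt (‖u τ x‖ ^ 2 + 1) * |⟪u τ x, fderiv ℝ (u τ) x (u τ x)⟫|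
        ≤ (M + 1) * (‖u τ x‖ * (‖fderiv ℝ (u τ) x‖ * M)) := by
          refine mul_le_mul (hρle x) ?_ (abs_nonneg _) (by linarith)
          refine (abs_real_inner_le_norm _ _).trans ?_
          gcongr
          exact (ContinuousLinearMap.le_opNorm _ _).trans (by gcongr; exact hM x)
      _ = (M + 1) * M * (‖u τ x‖ * ‖fderiv ℝ (u τ) x‖) := by ring
  have hgradc : Continuous fun x => gradient (q τ) x :=
    (InnerProductSpace.toDual ℝ E).symm.continuous.comp (hcq.continuous_fderiv one_ne_zero)
  have hI3 : Integrable (fun x => Real.sqrt (‖u τ x‖ ^ 2 + 1) * ⟪u τ x, gradient (q τ) x⟫) volume := by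
    refine Integrable.mono' ((integrable_norm_mul_norm hu2 hDq).const_mul (M + 1))
      ((hρc.mul (huc.inner hgradc)).aestronglyMeasurable) (Eventually.of_forall fun x => ?_)
    rw [norm_mul, Real.norm_eq_abs, abs_of_nonneg (hρ0 x), Real.norm_eq_abs]
    exact mul_le_mul (hρle x) (abs_real_inner_le_norm _ _) (abs_nonneg _) (by linarith)
  -- split the integrand along the momentum equation
  have hsplit : ∀ x, 3 * Real.sqrt (‖u τ x‖ ^ 2 + 1) * ⟪u τ x, timeDerivWithin S u τ x⟫ =
      3 * (ν * (Real.sqrt (‖u τ x‖ ^ 2 + 1) * ⟪u τ x, (Δ (u τ)) x⟫) -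
        Real.sqrt (‖u τ x‖ ^ 2 + 1) * ⟪u τ x, gradient (q τ) x⟫ -
        Real.sqrt (‖u τ x‖ ^ 2 + 1) * ⟪u τ x, fderiv ℝ (u τ) x (u τ x)⟫) := by
    intro x
    rw [hmom x, inner_sub_right, inner_sub_right, real_inner_smul_right]
    ring
  have hval : ∫ x, 3 * Real.sqrt (‖u τ x‖ ^ 2 + 1) * ⟪u τ x, timeDerivWithin S u τ x⟫ =
      3 * (ν * (∫ x, Real.sqrt (‖u τ x‖ ^ 2 + 1) * ⟪u τ x, (Δ (u τ)) x⟫) -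
        (∫ x, Real.sqrt (‖u τ x‖ ^ 2 + 1) * ⟪u τ x, gradient (q τ) x⟫) -
        (∫ x, Real.sqrt (‖u τ x‖ ^ 2 + 1) * ⟪u τ x, fderiv ℝ (u τ) x (u τ x)⟫)) := by
    have hI13 : Integrable (fun x => ν * (Real.sqrt (‖u τ x‖ ^ 2 + 1) * ⟪u τ x, (Δ (u τ)) x⟫) -
        Real.sqrt (‖u τ x‖ ^ 2 + 1) * ⟪u τ x, gradient (q τ) x⟫) volume := (hI1.const_mul ν).sub hI3
    simp_rw [hsplit]
    rw [integral_const_mul, integral_sub hI13 hI2, integral_sub (hI1.const_mul ν) hI3,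
      integral_const_mul]
  -- the three estimates
  have h1 : ν * (∫ x, Real.sqrt (‖u τ x‖ ^ 2 + 1) * ⟪u τ x, (Δ (u τ)) x⟫) ≤ 0 :=
    mul_nonpos_of_nonneg_of_nonpos hν (integral_rho_inner_laplacian_nonpos hu2' hM hu2 hDu hD2u)
  have h2 : ∫ x, Real.sqrt (‖u τ x‖ ^ 2 + 1) * ⟪u τ x, fderiv ℝ (u τ) x (u τ x)⟫ = 0 :=
    integral_rho_inner_convect_eq_zero hu1 hdiv hM hu2 hDu
  have h3 : |∫ x, Real.sqrt (‖u τ x‖ ^ 2 + 1) * ⟪u τ x, gradient (q τ) x⟫| ≤ M * (a * b) := by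
    have i0 := abs_integral_rho_inner_gradient_le hu1 hdiv hcq hM hu2 hDu hq2 hDq
    have hpt : ∀ x, ‖q τ x‖ * (‖u τ x‖ * ‖fderiv ℝ (u τ) x‖) ≤
        M * (‖q τ x‖ * ‖fderiv ℝ (u τ) x‖) := fun x => by
      have := mul_le_mul_of_nonneg_left (hM x) (mul_nonneg (norm_nonneg (q τ x))
        (norm_nonneg (fderiv ℝ (u τ) x)))
      nlinarith [norm_nonneg (q τ x), norm_nonneg (fderiv ℝ (u τ) x), norm_nonneg (u τ x)]
    have i1 : (∫ x, ‖q τ x‖ * (‖u τ x‖ * ‖fderiv ℝ (u τ) x‖)) ≤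
        (∫ x, M * (‖q τ x‖ * ‖fderiv ℝ (u τ) x‖)) :=
      integral_mono_of_nonneg (Eventually.of_forall fun x => by positivity)
        ((integrable_norm_mul_norm hq2 hDu).const_mul M) (Eventually.of_forall hpt)
    have i2 : (∫ x, M * (‖q τ x‖ * ‖fderiv ℝ (u τ) x‖)) =
        M * (∫ x, ‖q τ x‖ * ‖fderiv ℝ (u τ) x‖) := integral_const_mul _ _
    have i3 := mul_le_mul_of_nonneg_left
      (integral_norm_mul_norm_le_of_eLpNorm_le hq2 hDu ha hb hqa hDub) hM0
    linarith
  rw [hval, h2, sub_zero]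
  have h4 : -(M * (a * b)) ≤ (∫ x, Real.sqrt (‖u τ x‖ ^ 2 + 1) * ⟪u τ x, gradient (q τ) x⟫) :=
    (abs_le.1 h3).1
  nlinarith

end SliceBound


/-! ### Integrating in time: the regularised-cube inequality on a slab -/

section TimeIntegration

variable {E : Type*} [NormedAddCommGroup E] [InnerProductSpace ℝ E] [FiniteDimensional ℝ E]
  [MeasurableSpace E] [BorelSpace E]

omit [FiniteDimensional ℝ E] [MeasurableSpace E] [BorelSpace E] in
/-- **The regularised cube along a time line**: if `γ` has derivative `γ'` at `τ`, then
`s ↦ √(‖γ s‖²+1)³ − 1` has derivative `3 √(‖γ τ‖²+1) ⟪γ τ, γ'⟫` at `τ`. [folklore] -/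
theorem hasDerivAt_phi_timeLine {γ : ℝ → E} {γ' : E} {τ : ℝ} (hγ : HasDerivAt γ γ' τ) :
    HasDerivAt (fun s => Real.sqrt (‖γ s‖ ^ 2 + 1) ^ 3 - 1)
      (3 * Real.sqrt (‖γ τ‖ ^ 2 + 1) * ⟪γ τ, γ'⟫) τ := by
  have h := (hasFDerivAt_phi hγ.hasFDerivAt).hasDerivAt
  refine h.congr_deriv ?_
  simp only [_root_.smul_apply, ContinuousLinearMap.comp_apply, innerSL_apply_apply,
    ContinuousLinearMap.toSpanSingleton_apply, one_smul, smul_eq_mul]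

/-- **The regularised-cube inequality on a slab.** Let `(u, q)` be a classical solution of the
unforced Navier–Stokes system on the closed slab `[0, S] × E` (`S > 0`), bounded (`‖u‖ ≤ B`), with
`u(t), ∂ₜu(t) ∈ L²` uniformly on `[0, S]`. If the slice functional
`∫ 3ρ⟪u(τ), ∂ₜu(τ)⟫` (`ρ = √(‖u‖²+1)`) is bounded on `(0, S)` by an integrable `D(τ)`, then
`∫ Φ(u(S)) ≤ ∫ Φ(u(0)) + ∫_{(0,S)} D`, `Φ(v) = √(‖v‖²+1)³ − 1`. Proof: pointwise in `x` the
fundamental theorem of calculus for `τ ↦ Φ(u(τ, x))`, then Fubini on `(0, S) × E` (the integrand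
`3ρ⟪u, ∂ₜu⟫` is jointly continuous and dominated by `(3/2)(B+1)(‖u‖² + ‖∂ₜu‖²)`). No limiting
procedure, no spatial cut-off. [folklore] -/
theorem integral_phi_le_of_slice_le {ν S : ℝ} (hS : 0 < S)
    {u : ℝ → E → E} {q : ℝ → E → ℝ} (hcl : IsClassicalNSSolutionOn (Icc 0 S) ν 0 u q)
    {B : ℝ} (hBu : ∀ t ∈ Icc 0 S, ∀ x, ‖u t x‖ ≤ B)
    {C₀ Ct : ℝ≥0∞} (hC₀ : C₀ < ⊤) (hCt : Ct < ⊤)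
    (hu0 : ∀ t ∈ Icc 0 S, ∫⁻ x, ‖u t x‖ₑ ^ 2 ≤ C₀)
    (hut0 : ∀ t ∈ Icc 0 S, ∫⁻ x, ‖timeDerivWithin (Icc 0 S) u t x‖ₑ ^ 2 ≤ Ct)
    {D : ℝ → ℝ} (hDi : IntegrableOn D (Ioo 0 S))
    (hD : ∀ τ ∈ Ioo 0 S,
      ∫ x, 3 * Real.sqrt (‖u τ x‖ ^ 2 + 1) * ⟪u τ x, timeDerivWithin (Icc 0 S) u τ x⟫ ≤ D τ) :
    (∫ x, (Real.sqrt (‖u S x‖ ^ 2 + 1) ^ 3 - 1)) ≤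
      (∫ x, (Real.sqrt (‖u 0 x‖ ^ 2 + 1) ^ 3 - 1)) + (∫ τ in Ioo 0 S, D τ) := by
  have hB0 : 0 ≤ B := (norm_nonneg _).trans (hBu 0 ⟨le_rfl, hS.le⟩ 0)
  -- the space–time integrand, as an opaque function `g` with its defining equation
  obtain ⟨g, hg⟩ : ∃ g : ℝ → E → ℝ, ∀ τ x, g τ x =
      3 * Real.sqrt (‖u τ x‖ ^ 2 + 1) * ⟪u τ x, timeDerivWithin (Icc 0 S) u τ x⟫ :=
    ⟨fun τ x => 3 * Real.sqrt (‖u τ x‖ ^ 2 + 1) * ⟪u τ x, timeDerivWithin (Icc 0 S) u τ x⟫,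
      fun _ _ => rfl⟩
  have hgu : uncurry g = fun z : ℝ × E =>
      3 * Real.sqrt (‖uncurry u z‖ ^ 2 + 1) * ⟪uncurry u z, timeDerivWithin (Icc 0 S) u z.1 z.2⟫ :=
    funext fun z => hg z.1 z.2
  have hcontu : ContinuousOn (uncurry u) (Icc 0 S ×ˢ univ) := hcl.smooth_velocity.continuousOn
  have hcontut : ContinuousOn (fun z : ℝ × E => timeDerivWithin (Icc 0 S) u z.1 z.2)
      (Icc 0 S ×ˢ univ) := hcl.smooth_velocity.continuousOn_timeDerivWithin (uniqueDiffOn_Icc hS)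
  have hgc : ContinuousOn (uncurry g) (Icc 0 S ×ˢ univ) := by
    rw [hgu]
    have h1 : ContinuousOn (fun z : ℝ × E => Real.sqrt (‖uncurry u z‖ ^ 2 + 1)) (Icc 0 S ×ˢ univ) :=
      ((hcontu.norm.pow 2).add continuousOn_const).sqrt
    exact (continuousOn_const.mul h1).mul (hcontu.inner hcontut)
  -- pointwise bound `|g| ≤ 3(B+1) ‖u‖ ‖∂ₜu‖`
  have hgle : ∀ τ ∈ Icc 0 S, ∀ x, ‖g τ x‖ ≤
      3 * (B + 1) * (‖u τ x‖ * ‖timeDerivWithin (Icc 0 S) u τ x‖) := by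
    intro τ hτ x
    have hρ : Real.sqrt (‖u τ x‖ ^ 2 + 1) ≤ B + 1 :=
      (sqrt_normSq_add_one_le (u τ x)).trans (by linarith [hBu τ hτ x])
    rw [hg, Real.norm_eq_abs, abs_mul, abs_mul, abs_of_nonneg (Real.sqrt_nonneg _),
      abs_of_nonneg (by norm_num : (0:ℝ) ≤ 3)]
    exact mul_le_mul (mul_le_mul_of_nonneg_left hρ (by norm_num)) (abs_real_inner_le_norm _ _)
      (abs_nonneg _) (by positivity)
  -- (ii) the fundamental theorem of calculus along each time line
  have hFTC : ∀ x, (∫ τ in Ioo 0 S, g τ x) =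
      (Real.sqrt (‖u S x‖ ^ 2 + 1) ^ 3 - 1) - (Real.sqrt (‖u 0 x‖ ^ 2 + 1) ^ 3 - 1) := by
    intro x
    have hline : ContinuousOn (fun τ => u τ x) (Icc 0 S) :=
      hcontu.comp (continuousOn_id.prodMk continuousOn_const) fun τ hτ => ⟨hτ, mem_univ _⟩
    have hcontF : ContinuousOn (fun τ => Real.sqrt (‖u τ x‖ ^ 2 + 1) ^ 3 - 1) (Icc 0 S) :=
      (((hline.norm.pow 2).add continuousOn_const).sqrt.pow 3).sub continuousOn_const
    have hgline : ContinuousOn (fun τ => g τ x) (Icc 0 S) :=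
      hgc.comp (continuousOn_id.prodMk continuousOn_const) fun τ hτ => ⟨hτ, mem_univ _⟩
    have hderiv : ∀ τ ∈ Ioo 0 S, HasDerivAt (fun s => Real.sqrt (‖u s x‖ ^ 2 + 1) ^ 3 - 1)
        (g τ x) τ := by
      intro τ hτ
      have hl : HasDerivAt (fun s => u s x) (deriv (fun s => u s x) τ) τ :=
        (hcl.smooth_velocity.mono Ioo_subset_Icc_self).hasDerivAt_timeLine isOpen_Ioo hτ x
      rw [hg, timeDerivWithin_eq_deriv_of_mem_nhds (Icc_mem_nhds hτ.1 hτ.2) u x]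
      exact hasDerivAt_phi_timeLine hl
    rw [← integral_Ioc_eq_integral_Ioo, ← intervalIntegral.integral_of_le hS.le]
    exact intervalIntegral.integral_eq_sub_of_hasDerivAt_of_le hS.le hcontF hderiv
      (hgline.intervalIntegrable_of_Icc hS.le)
  -- (iii) integrability on the product `(0,S) × E`
  have hmeas : AEStronglyMeasurable (uncurry g) ((volume.restrict (Ioo 0 S)).prod volume) := by
    have hprod : (volume.restrict (Ioo 0 S)).prod (volume : Measure E) =
        (volume.prod volume).restrict (Ioo 0 S ×ˢ univ) := by
      rw [← Measure.restrict_univ (μ := (volume : Measure E)), Measure.prod_restrict,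
        Measure.restrict_univ]
    rw [hprod]
    exact (hgc.mono (prod_mono Ioo_subset_Icc_self Subset.rfl)).aestronglyMeasurable
      (measurableSet_Ioo.prod MeasurableSet.univ)
  have hpt : ∀ τ ∈ Icc 0 S, ∀ x, ‖uncurry g (τ, x)‖ₑ ≤ ENNReal.ofReal (3 * (B + 1)) *
      (‖u τ x‖ₑ ^ 2 + ‖timeDerivWithin (Icc 0 S) u τ x‖ₑ ^ 2) := by
    intro τ hτ x
    rw [uncurry_apply_pair, ← ofReal_norm (g τ x)]
    refine (ENNReal.ofReal_le_ofReal (hgle τ hτ x)).trans ?_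
    rw [ENNReal.ofReal_mul (by positivity), ENNReal.ofReal_mul (norm_nonneg _),
      ofReal_norm, ofReal_norm]
    exact mul_le_mul' le_rfl (FluidPDE.ennreal_mul_le_sq_add_sq _ _)
  have hslice : ∀ τ ∈ Ioo 0 S, ∫⁻ x, ‖uncurry g (τ, x)‖ₑ ≤ ENNReal.ofReal (3 * (B + 1)) * (C₀ + Ct) := by
    intro τ hτ
    have hτ' : τ ∈ Icc 0 S := Ioo_subset_Icc_self hτ
    have hm : AEMeasurable (fun x => ‖u τ x‖ₑ ^ 2) volume :=
      (hcl.contDiff_velocity hτ').continuous.aemeasurable.enorm.pow_const _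
    calc ∫⁻ x, ‖uncurry g (τ, x)‖ₑ
        ≤ ∫⁻ x, ENNReal.ofReal (3 * (B + 1)) *
            (‖u τ x‖ₑ ^ 2 + ‖timeDerivWithin (Icc 0 S) u τ x‖ₑ ^ 2) :=
          lintegral_mono fun x => hpt τ hτ' x
      _ = ENNReal.ofReal (3 * (B + 1)) *
            ((∫⁻ x, ‖u τ x‖ₑ ^ 2) + ∫⁻ x, ‖timeDerivWithin (Icc 0 S) u τ x‖ₑ ^ 2) := by
          rw [lintegral_const_mul' _ _ ENNReal.ofReal_ne_top, lintegral_add_left' hm]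
      _ ≤ ENNReal.ofReal (3 * (B + 1)) * (C₀ + Ct) :=
          mul_le_mul' le_rfl (add_le_add (hu0 τ hτ') (hut0 τ hτ'))
  have hfin : HasFiniteIntegral (uncurry g) ((volume.restrict (Ioo 0 S)).prod volume) := by
    refine lt_of_le_of_lt (lintegral_prod_le _) ?_
    refine lt_of_le_of_lt (setLIntegral_mono' measurableSet_Ioo fun τ hτ => hslice τ hτ) ?_
    rw [setLIntegral_const]
    refine ENNReal.mul_lt_top (ENNReal.mul_lt_top ENNReal.ofReal_lt_top ?_) ?_
    · exact ENNReal.add_lt_top.2 ⟨hC₀, hCt⟩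
    · simp
  have hint : Integrable (uncurry g) ((volume.restrict (Ioo 0 S)).prod volume) := ⟨hmeas, hfin⟩
  -- (iv) Fubini and assembly
  have hswap : (∫ x, ∫ τ in Ioo 0 S, g τ x) = (∫ τ in Ioo 0 S, ∫ x, g τ x) :=
    integral_integral_swap hint.swap
  have hΦint : ∀ t ∈ Icc 0 S, Integrable (fun x => Real.sqrt (‖u t x‖ ^ 2 + 1) ^ 3 - 1) volume := by
    intro t ht
    have hc : Continuous (u t) := (hcl.contDiff_velocity ht).continuous
    have h2 : MemLp (u t) 2 volume :=
      ⟨hc.aestronglyMeasurable, eLpNorm_two_lt_top_of_lintegral_enorm_sq_lt_top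
        ((hu0 t ht).trans_lt hC₀)⟩
    refine Integrable.mono' ((integrable_norm_sq h2).const_mul (B + 3 / 2))
      ((((hc.norm.pow 2).add continuous_const).sqrt.pow 3).sub continuous_const).aestronglyMeasurable
      (Eventually.of_forall fun x => ?_)
    rw [Real.norm_eq_abs, abs_of_nonneg (phi_nonneg (u t x))]
    refine (phi_le (u t x)).trans ?_
    gcongr
    exact hBu t ht x
  have hL : (∫ x, ∫ τ in Ioo 0 S, g τ x) =
      (∫ x, (Real.sqrt (‖u S x‖ ^ 2 + 1) ^ 3 - 1)) - (∫ x, (Real.sqrt (‖u 0 x‖ ^ 2 + 1) ^ 3 - 1)) := by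
    rw [← integral_sub (hΦint S ⟨hS.le, le_rfl⟩) (hΦint 0 ⟨le_rfl, hS.le⟩)]
    exact integral_congr_ae (Eventually.of_forall fun x => hFTC x)
  have hD' : ∀ τ ∈ Ioo 0 S, (∫ x, g τ x) ≤ D τ := fun τ hτ => by
    have e : (fun x => g τ x) = fun x =>
        3 * Real.sqrt (‖u τ x‖ ^ 2 + 1) * ⟪u τ x, timeDerivWithin (Icc 0 S) u τ x⟫ :=
      funext fun x => hg τ x
    rw [e]
    exact hD τ hτ
  have hR : (∫ τ in Ioo 0 S, ∫ x, g τ x) ≤ (∫ τ in Ioo 0 S, D τ) :=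
    integral_mono_ae hint.integral_prod_left hDi
      ((ae_restrict_iff' measurableSet_Ioo).2 (Eventually.of_forall hD'))
  rw [hswap] at hL
  linarith

end TimeIntegration

end LogCubeSharp

end Summit.NavierStokesRegularity.NavierStokesRegularity.Theorems

end
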